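import Literature.NumberTheory.Rogawski1990.ArchOrbFamGScalarCornerBookkeeping   -- ★ p851280 (F0P3a-p09 (g7)): (s1) `exists_contDiff_cptFactor_eq_mul_rootProduct_sub` (the SCALAR-place twin); brings ★ `one_sub_cexp_mul_I_eq`, `contDiff_dslope_cexp_zero`
import HarnessLib

/-!
# (B3-JUNCTION, MIXED CORNER) The compact Weyl factor of `archRG` at a FACE = entire × `2 sin ψ`

Sub-problem `HC_CM` of `HodgeConjecture`, route `HCCMUnconditional`, crux H413 `stub_N9` (stmt-24833), LH3 leaf organ **O-L1d′** (`hCm`, mixed corners): the FACE half of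
the cofactor dress of F0P3a-p08 (g23)'s mixed-tower assembly (the scalar half is ★ (s1) `exists_contDiff_cptFactor_eq_mul_rootProduct_sub`).  THEOREMS ONLY, lane
`--supports stmt-HodgeConjecture-24833`.

THE MATHEMATICS.  The compact factor of the normaliser `R′_{S′}` at a compact-chart place `w` (★ `archRG_eq_prod_cpt_mul_prod_split`, the token of ★ (M1)
`orbFamG_eq_unfoldedModel_pi_isolate_of_regG`) is `W(c_w) = (1 − e^{i(c_{w1} − c_{w0})})(1 − e^{i(c_{w2} − c_{w0})})(1 − e^{i(c_{w2} − c_{w1})})`.  With the face angle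
`ψ = (c_{w0} − c_{w2})∕2` of the noncompact pair `(0,2)`: `1 − e^{i(c_{w2} − c_{w0})} = 1 − e^{−2iψ} = e^{−iψ}(e^{iψ} − e^{−iψ}) = i e^{−iψ} · 2 sin ψ`, so
`W(c_w) = v(c) · 2 sin ψ(c)` with `v(c) = i e^{−iψ(c)} (1 − e^{i(c_{w1} − c_{w0})})(1 − e^{i(c_{w2} − c_{w1})})` real-smooth on the WHOLE coordinate space (no division):
`cptFactor_eq_faceUnit_mul_two_sin`, `contDiff_faceUnit`, packaged as `exists_contDiff_cptFactor_eq_mul_two_sin`.  This is the `u`-half of the J1-MIXED `hfac` at the faces: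
the mixed tower of ★ `contDiffOn_and_forall_bound_mixedTower` carries `(∏ 2 sin ψ_k) •` in its face stage.
[Rogawski1990, §8.2 p. 122 (the normalising factor); Shelstad1979, §4 p. 22; WarnerHASSLG2, §8.4.1.]
-/

noncomputable section

open Complex
open scoped Real ContDiff

namespace Literature.NumberTheory.Rogawski1990

section FaceFactor

variable {W : Type*} (w : W)

/-- `1 − E⁻² = i E⁻ (E⁻ − E⁺) i` for `E^± = e^{±iz}` (pure algebra: `E⁻E⁺ = 1`, `i² = −1`). [cite: WarnerHASSLG2, §8.4.1] -/
private theorem one_sub_exp_neg_sq_eq (z : ℂ) :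
    1 - Complex.exp (-z * I) * Complex.exp (-z * I) = I * Complex.exp (-z * I) * ((Complex.exp (-z * I) - Complex.exp (z * I)) * I) := by
  have hE : Complex.exp (-z * I) * Complex.exp (z * I) = 1 := by
    rw [← Complex.exp_add, ← Complex.exp_zero]; congr 1; ring
  linear_combination (Complex.exp (-z * I) * Complex.exp (z * I) - Complex.exp (-z * I) * Complex.exp (-z * I)) * Complex.I_sq - hE

/-- `1 − e^{−2iψ} = (i e^{−iψ}) · 2 sin ψ` in the chart's tokens: `1 − ↑(Circle.exp (c₂ − c₀)) = (I · exp(−((c₀ − c₂)∕2) I)) · ↑(2 sin ((c₀ − c₂)∕2))`.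
[cite: WarnerHASSLG2, §8.4.1] -/
theorem one_sub_circleExp_eq_mul_two_sin (a b : ℝ) :
    1 - (Circle.exp (b - a) : ℂ) = (I * Complex.exp (-(((a - b) / 2 : ℝ) : ℂ) * I)) * ((2 * Real.sin ((a - b) / 2) : ℝ) : ℂ) := by
  rw [Circle.coe_exp]
  have h2 : ((b - a : ℝ) : ℂ) * I = -(((a - b) / 2 : ℝ) : ℂ) * I + -(((a - b) / 2 : ℝ) : ℂ) * I := by push_cast; ring
  rw [h2, Complex.exp_add]
  push_cast
  rw [Complex.two_sin]
  exact one_sub_exp_neg_sq_eq _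

/-- **THE COMPACT WEYL FACTOR AT A FACE = UNIT × `2 sin ψ`**, pointwise: with `ψ(c) = (c_{w0} − c_{w2})∕2`,
`(1 − e^{i(c_{w1}−c_{w0})})(1 − e^{i(c_{w2}−c_{w0})})(1 − e^{i(c_{w2}−c_{w1})}) = [i e^{−iψ(c)} (1 − e^{i(c_{w1}−c_{w0})})(1 − e^{i(c_{w2}−c_{w1})})] · 2 sin ψ(c)`.
[cite: Rogawski1990, §8.2 p. 122] [cite: WarnerHASSLG2, §8.4.1] -/
theorem cptFactor_eq_faceUnit_mul_two_sin (c : W → Fin 3 → ℝ) :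
    (1 - (Circle.exp (c w 1 - c w 0) : ℂ)) * (1 - (Circle.exp (c w 2 - c w 0) : ℂ)) * (1 - (Circle.exp (c w 2 - c w 1) : ℂ)) =
      (I * Complex.exp (-(((c w 0 - c w 2) / 2 : ℝ) : ℂ) * I) * (1 - (Circle.exp (c w 1 - c w 0) : ℂ)) * (1 - (Circle.exp (c w 2 - c w 1) : ℂ))) *
        ((2 * Real.sin ((c w 0 - c w 2) / 2) : ℝ) : ℂ) := by
  rw [one_sub_circleExp_eq_mul_two_sin (c w 0) (c w 2)]
  ring

/-- The face unit `v(c) = i e^{−iψ(c)} (1 − e^{i(c_{w1}−c_{w0})})(1 − e^{i(c_{w2}−c_{w1})})` is real-smooth on the whole coordinate space. [cite: WarnerHASSLG2, §8.4.1] -/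
theorem contDiff_faceUnit [Fintype W] :
    ContDiff ℝ ∞ fun c : W → Fin 3 → ℝ =>
      I * Complex.exp (-(((c w 0 - c w 2) / 2 : ℝ) : ℂ) * I) * (1 - (Circle.exp (c w 1 - c w 0) : ℂ)) * (1 - (Circle.exp (c w 2 - c w 1) : ℂ)) := by
  have hco : ∀ i j : Fin 3, ContDiff ℝ ∞ (fun c : W → Fin 3 → ℝ => ((c w i - c w j : ℝ) : ℂ)) := fun i j =>
    Complex.ofRealCLM.contDiff.comp ((contDiff_apply_apply ℝ ℝ w i).sub (contDiff_apply_apply ℝ ℝ w j))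
  have hψ : ContDiff ℝ ∞ (fun c : W → Fin 3 → ℝ => -(((c w 0 - c w 2) / 2 : ℝ) : ℂ) * I) := by
    have h : ContDiff ℝ ∞ (fun c : W → Fin 3 → ℝ => (((c w 0 - c w 2) / 2 : ℝ) : ℂ)) :=
      Complex.ofRealCLM.contDiff.comp (((contDiff_apply_apply ℝ ℝ w 0).sub (contDiff_apply_apply ℝ ℝ w 2)).div_const _)
    exact h.neg.mul contDiff_const
  have hcirc : ∀ i j : Fin 3, ContDiff ℝ ∞ (fun c : W → Fin 3 → ℝ => (1 - (Circle.exp (c w i - c w j) : ℂ))) := by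
    intro i j
    have h : (fun c : W → Fin 3 → ℝ => (1 - (Circle.exp (c w i - c w j) : ℂ))) = fun c => 1 - Complex.exp (((c w i - c w j : ℝ) : ℂ) * I) := by
      funext c; rw [Circle.coe_exp]
    rw [h]
    exact contDiff_const.sub (Complex.contDiff_exp.comp ((hco i j).mul contDiff_const))
  exact ((contDiff_const.mul (Complex.contDiff_exp.comp hψ)).mul (hcirc 1 0)).mul (hcirc 2 1)

/-- **(D-face) PACKAGED**: there is a real-smooth `v` on the whole coordinate space with `W(c_w) = v(c) · 2 sin ((c_{w0} − c_{w2})∕2)` for EVERY `c` — the face twin of ★ (s1)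
`exists_contDiff_cptFactor_eq_mul_rootProduct_sub`. [cite: Rogawski1990, §8.2 p. 122] [cite: Shelstad1979, §4 p. 22] [cite: WarnerHASSLG2, §8.4.1] -/
theorem exists_contDiff_cptFactor_eq_mul_two_sin [Fintype W] :
    ∃ v : (W → Fin 3 → ℝ) → ℂ, ContDiff ℝ ∞ v ∧ ∀ c : W → Fin 3 → ℝ,
      (1 - (Circle.exp (c w 1 - c w 0) : ℂ)) * (1 - (Circle.exp (c w 2 - c w 0) : ℂ)) * (1 - (Circle.exp (c w 2 - c w 1) : ℂ)) =
        v c * ((2 * Real.sin ((c w 0 - c w 2) / 2) : ℝ) : ℂ) :=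
  ⟨_, contDiff_faceUnit w, cptFactor_eq_faceUnit_mul_two_sin w⟩

end FaceFactor

end Literature.NumberTheory.Rogawski1990

end
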